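import Summits.NavierStokesRegularity.NavierStokesRegularity.Theses.RellichScar
import Summits.NavierStokesRegularity.NavierStokesRegularity.Theorems.ScarRigidity.Negative.LogicAndLoadBearing
import Literature.Analysis.FluidPDE.TypeIAncientMild
import Literature.Analysis.FluidPDE.ParasiticSlabFlow
import Summits.NavierStokesRegularity.NavierStokesRegularity.Theorems.RellichScarScarRigidityCoulombKernel
import HarnessLib

/-!
# `ScarRigidity` — line `finite-energy-log-convexity`, stub `stub_coulombEnergyPackage`:
# pointwise decay of the Newtonian potential of an apex density and of its derivatives
# (crux stmt-NavierStokesRegularity-11717)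

Helper file 5 of S4-E (`stub_coulombEnergyPackage`). For a density with the apex bounds
`‖w‖ ≤ A ρ⁻³`, `‖Dw‖ ≤ A₁ ρ⁻²`, `‖D²w‖ ≤ A₂ ρ⁻³` (`ρ = ‖y‖ + a`, `a > 0`) the four integrals making up
`ψ = Γ ⋆ w` and its first two derivatives (near part on the density, far part on the kernel; see
`…CoulombPoisson`) obey the crude decay

* `∫ |Γ(x-y)| ‖w(y)‖ dy ≤ K A a^{-1/4} ‖x‖^{-3/4}` (`integral_norm_newtonKernel_smul_le`);
* far gradient / Hessian integrals `≤ P A ‖b‖ min(1, ‖x‖^{-7/4})`, `≤ P A ‖b‖‖c‖ min(1, ‖x‖^{-5/2})`;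
* near gradient / Hessian integrals `≤ P A₁ ‖b‖ min(1, ‖x‖^{-7/4})`, `≤ P A₂ ‖b‖‖c‖ min(1, ‖x‖^{-5/2})`,

all from `ρ⁻³ ≤ a^{-1/4} ‖y‖^{-11/4}` and the Riesz composition bound with exponents
`(11/4, 1)`, `(11/4, 2)`, `(11/4, 11/4)` (Stein V §1), resp. the support of `Γ₀` in `‖z‖ ≤ 2`.
The exponents `3/4, 7/4, 5/2` are what makes every product in the Green identities of the package
integrable (e.g. `‖D²ψ‖ ‖ψ‖ ≲ ‖x‖^{-13/4}`).
-/

noncomputable section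

open Set Filter Function MeasureTheory Metric TopologicalSpace
open scoped Topology ENNReal NNReal InnerProductSpace RealInnerProductSpace
open Literature.Analysis.FluidPDE
open Summit.NavierStokesRegularity.NavierStokesRegularity.Theses.RellichScar
open Summit.NavierStokesRegularity.NavierStokesRegularity.Theorems.ScarRigidity.Negative

set_option linter.dupNamespace false

namespace Summit.NavierStokesRegularity.NavierStokesRegularity.Theorems.RellichScarScarRigidity

open Real

/-! ## Almost every point avoids two given points -/

/-- `y ≠ c` for a.e. `y` (points are Lebesgue-null). [folklore] -/
theorem ae_ne_point (c : EuclideanSpace ℝ (Fin 3)) :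
    ∀ᵐ y ∂(volume : Measure (EuclideanSpace ℝ (Fin 3))), y ≠ c := by
  rw [ae_iff]
  simp [measure_singleton]

/-! ## The potential itself -/

/-- **`∫ |Γ(x-y)| ‖w(y)‖ dy ≤ K A a^{-1/4} ‖x‖^{-3/4}` for `x ≠ 0`** whenever `‖w(y)‖ ≤ A/(‖y‖+a)³`
(`|Γ(z)| = (4π|z|)⁻¹`, `ρ⁻³ ≤ a^{-1/4}‖y‖^{-11/4}`, Riesz composition with exponents `(11/4, 1)`);
`K` is absolute. No measurability of `w` is needed. [folklore] -/
theorem exists_integral_norm_newtonKernel_smul_le :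
    ∃ K : ℝ, 0 ≤ K ∧ ∀ (a A : ℝ), 0 < a → 0 ≤ A →
      ∀ w : (EuclideanSpace ℝ (Fin 3)) → (EuclideanSpace ℝ (Fin 3)),
        (∀ y, ‖w y‖ ≤ A * ((‖y‖ + a) ^ 3)⁻¹) →
        ∀ x : EuclideanSpace ℝ (Fin 3), x ≠ 0 →
          ∫ y, ‖newtonKernel (x - y) • w y‖ ≤ K * A * a ^ (-(1 / 4 : ℝ)) * ‖x‖ ^ (-(3 / 4 : ℝ)) := by
  obtain ⟨K, hK, hR⟩ := exists_integral_rpow_mul_rpow_le (α := 11 / 4) (β := 1) (by norm_num)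
    (by norm_num) (by norm_num) (by norm_num) (by norm_num)
  refine ⟨(4 * π)⁻¹ * K, by positivity, fun a A ha hA w hw x hx => ?_⟩
  obtain ⟨hint, hle⟩ := hR x hx
  rw [show (3 : ℝ) - 11 / 4 - 1 = -(3 / 4 : ℝ) by norm_num] at hle
  have hθ : a ^ ((11 / 4 : ℝ) - 3) = a ^ (-(1 / 4 : ℝ)) := by norm_num
  have hpt : ∀ᵐ y ∂(volume : Measure (EuclideanSpace ℝ (Fin 3))),
      ‖newtonKernel (x - y) • w y‖ ≤
        (4 * π)⁻¹ * A * a ^ (-(1 / 4 : ℝ)) * (‖x - y‖ ^ (-(1 : ℝ)) * ‖y‖ ^ (-(11 / 4 : ℝ))) := by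
    filter_upwards [ae_ne_point 0] with y hy
    have h1 : |newtonKernel (x - y)| = (4 * π)⁻¹ * ‖x - y‖ ^ (-(1 : ℝ)) := by
      rw [abs_newtonKernel, Real.rpow_neg_one, mul_inv]
    have h2 : ((‖y‖ + a) ^ 3)⁻¹ ≤ a ^ (-(1 / 4 : ℝ)) * ‖y‖ ^ (-(11 / 4 : ℝ)) := by
      rw [← hθ]; exact inv_norm_add_cube_le_rpow ha (by norm_num) (by norm_num) hy
    rw [norm_smul, Real.norm_eq_abs, h1]
    calc (4 * π)⁻¹ * ‖x - y‖ ^ (-(1 : ℝ)) * ‖w y‖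
        ≤ (4 * π)⁻¹ * ‖x - y‖ ^ (-(1 : ℝ)) * (A * (a ^ (-(1 / 4 : ℝ)) * ‖y‖ ^ (-(11 / 4 : ℝ)))) :=
          mul_le_mul_of_nonneg_left ((hw y).trans (mul_le_mul_of_nonneg_left h2 hA))
            (by positivity)
      _ = (4 * π)⁻¹ * A * a ^ (-(1 / 4 : ℝ)) * (‖x - y‖ ^ (-(1 : ℝ)) * ‖y‖ ^ (-(11 / 4 : ℝ))) := by
          ring
  calc ∫ y, ‖newtonKernel (x - y) • w y‖
      ≤ ∫ y, (4 * π)⁻¹ * A * a ^ (-(1 / 4 : ℝ)) * (‖x - y‖ ^ (-(1 : ℝ)) * ‖y‖ ^ (-(11 / 4 : ℝ))) :=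
        integral_mono_of_nonneg (Eventually.of_forall fun y => norm_nonneg _) (hint.const_mul _) hpt
    _ = (4 * π)⁻¹ * A * a ^ (-(1 / 4 : ℝ)) * ∫ y, ‖x - y‖ ^ (-(1 : ℝ)) * ‖y‖ ^ (-(11 / 4 : ℝ)) :=
        integral_const_mul _ _
    _ ≤ (4 * π)⁻¹ * A * a ^ (-(1 / 4 : ℝ)) * (K * ‖x‖ ^ (-(3 / 4 : ℝ))) :=
        mul_le_mul_of_nonneg_left hle (by positivity)
    _ = (4 * π)⁻¹ * K * A * a ^ (-(1 / 4 : ℝ)) * ‖x‖ ^ (-(3 / 4 : ℝ)) := by ring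

/-! ## The far integrals -/

/-- **Far gradient / Hessian integrals of an apex density.** For the far kernel `Γ∞ = newtonFar 1 2`
and `a > 0` there is `P ≥ 0` with, for every `A ≥ 0` and every `w` with `‖w(y)‖ ≤ A/(‖y‖+a)³`:
`∫ ‖∂_bΓ∞(x-y) w(y)‖ dy ≤ P A ‖b‖`, and `≤ P A ‖b‖ ‖x‖^{-7/4}` for `x ≠ 0`;
`∫ ‖∂_c∂_bΓ∞(x-y) w(y)‖ dy ≤ P A ‖b‖‖c‖`, and `≤ P A ‖b‖‖c‖ ‖x‖^{-5/2}` for `x ≠ 0`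
(uniform weights of `…CoulombKernel`; Riesz composition with exponents `(11/4, 2)`, `(11/4, 11/4)`). [folklore] -/
theorem exists_far_integrals_le {a : ℝ} (ha : 0 < a) :
    ∃ P : ℝ, 0 ≤ P ∧ ∀ (A : ℝ), 0 ≤ A →
      ∀ w : (EuclideanSpace ℝ (Fin 3)) → (EuclideanSpace ℝ (Fin 3)),
        (∀ y, ‖w y‖ ≤ A * ((‖y‖ + a) ^ 3)⁻¹) →
        ∀ x b c : EuclideanSpace ℝ (Fin 3),
          (∫ y, ‖fderiv ℝ (newtonFar 1 2) (x - y) b • w y‖ ≤ P * A * ‖b‖) ∧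
          (x ≠ 0 → ∫ y, ‖fderiv ℝ (newtonFar 1 2) (x - y) b • w y‖ ≤
            P * A * ‖b‖ * ‖x‖ ^ (-(7 / 4 : ℝ))) ∧
          (∫ y, ‖fderiv ℝ (fun z => fderiv ℝ (newtonFar 1 2) z b) (x - y) c • w y‖ ≤
            P * A * ‖b‖ * ‖c‖) ∧
          (x ≠ 0 → ∫ y, ‖fderiv ℝ (fun z => fderiv ℝ (newtonFar 1 2) z b) (x - y) c • w y‖ ≤
            P * A * ‖b‖ * ‖c‖ * ‖x‖ ^ (-(5 / 2 : ℝ))) := by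
  obtain ⟨K₁, hK₁, h1⟩ := exists_norm_fderiv_newtonFar_le
  obtain ⟨K₂, hK₂, h2⟩ := exists_norm_fderiv_fderiv_newtonFar_apply_le
  obtain ⟨R₁, hR₁, hR1⟩ := exists_integral_rpow_mul_rpow_le (α := 11 / 4) (β := 2) (by norm_num)
    (by norm_num) (by norm_num) (by norm_num) (by norm_num)
  obtain ⟨R₂, hR₂, hR2⟩ := exists_integral_rpow_mul_rpow_le (α := 11 / 4) (β := 11 / 4) (by norm_num)
    (by norm_num) (by norm_num) (by norm_num) (by norm_num)
  -- the uniform weights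
  set W₂ : ℝ := ((∫ y : EuclideanSpace ℝ (Fin 3), ((1 + ‖y‖) ^ (2 * 2))⁻¹) +
    ∫ y : EuclideanSpace ℝ (Fin 3), ((‖y‖ + a) ^ 6)⁻¹) / 2 with hW₂
  set W₃ : ℝ := ((∫ y : EuclideanSpace ℝ (Fin 3), ((1 + ‖y‖) ^ (2 * 3))⁻¹) +
    ∫ y : EuclideanSpace ℝ (Fin 3), ((‖y‖ + a) ^ 6)⁻¹) / 2 with hW₃
  have hW₂0 : 0 ≤ W₂ := by positivity
  have hW₃0 : 0 ≤ W₃ := by positivity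
  have hθ : a ^ ((11 / 4 : ℝ) - 3) = a ^ (-(1 / 4 : ℝ)) := by norm_num
  set P : ℝ := K₁ * W₂ + K₁ * a ^ (-(1 / 4 : ℝ)) * R₁ + K₂ * W₃ + K₂ * a ^ (-(1 / 4 : ℝ)) * R₂
    with hP
  have ha4 : 0 ≤ a ^ (-(1 / 4 : ℝ)) := Real.rpow_nonneg ha.le _
  have hn1 : 0 ≤ K₁ * W₂ := mul_nonneg hK₁ hW₂0
  have hn2 : 0 ≤ K₁ * a ^ (-(1 / 4 : ℝ)) * R₁ := mul_nonneg (mul_nonneg hK₁ ha4) hR₁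
  have hn3 : 0 ≤ K₂ * W₃ := mul_nonneg hK₂ hW₃0
  have hn4 : 0 ≤ K₂ * a ^ (-(1 / 4 : ℝ)) * R₂ := mul_nonneg (mul_nonneg hK₂ ha4) hR₂
  have hPa : K₁ * W₂ ≤ P := by rw [hP]; linarith
  have hPb : K₁ * a ^ (-(1 / 4 : ℝ)) * R₁ ≤ P := by rw [hP]; linarith
  have hPc : K₂ * W₃ ≤ P := by rw [hP]; linarith
  have hPd : K₂ * a ^ (-(1 / 4 : ℝ)) * R₂ ≤ P := by rw [hP]; linarith
  have hP0 : 0 ≤ P := le_trans (mul_nonneg hK₁ hW₂0) hPa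
  refine ⟨P, hP0, fun A hA w hw x b c => ?_⟩
  -- pointwise bounds of the two integrands
  have hρ : ∀ y : EuclideanSpace ℝ (Fin 3), y ≠ 0 →
      ((‖y‖ + a) ^ 3)⁻¹ ≤ a ^ (-(1 / 4 : ℝ)) * ‖y‖ ^ (-(11 / 4 : ℝ)) := fun y hy => by
    rw [← hθ]; exact inv_norm_add_cube_le_rpow ha (by norm_num) (by norm_num) hy
  have hg1 : ∀ y, ‖fderiv ℝ (newtonFar 1 2) (x - y) b • w y‖ ≤
      K₁ * A * ‖b‖ * (((1 + ‖x - y‖) ^ 2)⁻¹ * ((‖y‖ + a) ^ 3)⁻¹) := fun y => by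
    rw [norm_smul, Real.norm_eq_abs]
    calc |fderiv ℝ (newtonFar 1 2) (x - y) b| * ‖w y‖
        ≤ (K₁ * ((1 + ‖x - y‖) ^ 2)⁻¹ * ‖b‖) * (A * ((‖y‖ + a) ^ 3)⁻¹) := by
          refine mul_le_mul ?_ (hw y) (norm_nonneg _) (by positivity)
          rw [← Real.norm_eq_abs]
          exact (ContinuousLinearMap.le_opNorm _ _).trans
            (mul_le_mul_of_nonneg_right (h1 _) (norm_nonneg _))
      _ = K₁ * A * ‖b‖ * (((1 + ‖x - y‖) ^ 2)⁻¹ * ((‖y‖ + a) ^ 3)⁻¹) := by ring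
  have hg2 : ∀ y, ‖fderiv ℝ (fun z => fderiv ℝ (newtonFar 1 2) z b) (x - y) c • w y‖ ≤
      K₂ * A * ‖b‖ * ‖c‖ * (((1 + ‖x - y‖) ^ 3)⁻¹ * ((‖y‖ + a) ^ 3)⁻¹) := fun y => by
    rw [norm_smul, Real.norm_eq_abs]
    calc |fderiv ℝ (fun z => fderiv ℝ (newtonFar 1 2) z b) (x - y) c| * ‖w y‖
        ≤ (K₂ * ‖b‖ * ((1 + ‖x - y‖) ^ 3)⁻¹ * ‖c‖) * (A * ((‖y‖ + a) ^ 3)⁻¹) := by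
          refine mul_le_mul ?_ (hw y) (norm_nonneg _) (by positivity)
          rw [← Real.norm_eq_abs]
          exact (ContinuousLinearMap.le_opNorm _ _).trans
            (mul_le_mul_of_nonneg_right (h2 _ b) (norm_nonneg _))
      _ = K₂ * A * ‖b‖ * ‖c‖ * (((1 + ‖x - y‖) ^ 3)⁻¹ * ((‖y‖ + a) ^ 3)⁻¹) := by ring
  obtain ⟨hi2, hI2⟩ := integrable_inv_pow_mul_inv_cube x ha (le_refl 2)
  obtain ⟨hi3, hI3⟩ := integrable_inv_pow_mul_inv_cube x ha (by norm_num : 2 ≤ 3)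
  refine ⟨?_, fun hx => ?_, ?_, fun hx => ?_⟩
  · -- global gradient bound
    calc ∫ y, ‖fderiv ℝ (newtonFar 1 2) (x - y) b • w y‖
        ≤ ∫ y, K₁ * A * ‖b‖ * (((1 + ‖x - y‖) ^ 2)⁻¹ * ((‖y‖ + a) ^ 3)⁻¹) :=
          integral_mono_of_nonneg (Eventually.of_forall fun y => norm_nonneg _) (hi2.const_mul _)
            (Eventually.of_forall hg1)
      _ ≤ K₁ * A * ‖b‖ * W₂ := by
          rw [integral_const_mul]; exact mul_le_mul_of_nonneg_left hI2 (by positivity)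
      _ = (K₁ * W₂) * A * ‖b‖ := by ring
      _ ≤ P * A * ‖b‖ := by gcongr
  · -- gradient decay
    obtain ⟨hint, hle⟩ := hR1 x hx
    rw [show (3 : ℝ) - 11 / 4 - 2 = -(7 / 4 : ℝ) by norm_num] at hle
    have hpt : ∀ᵐ y ∂(volume : Measure (EuclideanSpace ℝ (Fin 3))),
        ‖fderiv ℝ (newtonFar 1 2) (x - y) b • w y‖ ≤
          K₁ * A * ‖b‖ * a ^ (-(1 / 4 : ℝ)) * (‖x - y‖ ^ (-(2 : ℝ)) * ‖y‖ ^ (-(11 / 4 : ℝ))) := by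
      filter_upwards [ae_ne_point 0, ae_ne_point x] with y hy0 hyx
      have hxy : x - y ≠ 0 := sub_ne_zero.2 (Ne.symm hyx)
      have hk : ((1 + ‖x - y‖) ^ 2)⁻¹ ≤ ‖x - y‖ ^ (-(2 : ℝ)) :=
        inv_one_add_norm_pow_le_rpow (by norm_num) (by norm_num) hxy
      calc ‖fderiv ℝ (newtonFar 1 2) (x - y) b • w y‖
          ≤ K₁ * A * ‖b‖ * (((1 + ‖x - y‖) ^ 2)⁻¹ * ((‖y‖ + a) ^ 3)⁻¹) := hg1 y
        _ ≤ K₁ * A * ‖b‖ * (‖x - y‖ ^ (-(2 : ℝ)) * (a ^ (-(1 / 4 : ℝ)) * ‖y‖ ^ (-(11 / 4 : ℝ)))) :=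
            mul_le_mul_of_nonneg_left (mul_le_mul hk (hρ y hy0) (by positivity) (by positivity))
              (by positivity)
        _ = K₁ * A * ‖b‖ * a ^ (-(1 / 4 : ℝ)) * (‖x - y‖ ^ (-(2 : ℝ)) * ‖y‖ ^ (-(11 / 4 : ℝ))) := by
            ring
    calc ∫ y, ‖fderiv ℝ (newtonFar 1 2) (x - y) b • w y‖
        ≤ ∫ y, K₁ * A * ‖b‖ * a ^ (-(1 / 4 : ℝ)) * (‖x - y‖ ^ (-(2 : ℝ)) * ‖y‖ ^ (-(11 / 4 : ℝ))) :=
          integral_mono_of_nonneg (Eventually.of_forall fun y => norm_nonneg _) (hint.const_mul _) hpt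
      _ ≤ K₁ * A * ‖b‖ * a ^ (-(1 / 4 : ℝ)) * (R₁ * ‖x‖ ^ (-(7 / 4 : ℝ))) := by
          rw [integral_const_mul]; exact mul_le_mul_of_nonneg_left hle (by positivity)
      _ = (K₁ * a ^ (-(1 / 4 : ℝ)) * R₁) * A * ‖b‖ * ‖x‖ ^ (-(7 / 4 : ℝ)) := by ring
      _ ≤ P * A * ‖b‖ * ‖x‖ ^ (-(7 / 4 : ℝ)) := by gcongr
  · -- global Hessian bound
    calc ∫ y, ‖fderiv ℝ (fun z => fderiv ℝ (newtonFar 1 2) z b) (x - y) c • w y‖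
        ≤ ∫ y, K₂ * A * ‖b‖ * ‖c‖ * (((1 + ‖x - y‖) ^ 3)⁻¹ * ((‖y‖ + a) ^ 3)⁻¹) :=
          integral_mono_of_nonneg (Eventually.of_forall fun y => norm_nonneg _) (hi3.const_mul _)
            (Eventually.of_forall hg2)
      _ ≤ K₂ * A * ‖b‖ * ‖c‖ * W₃ := by
          rw [integral_const_mul]; exact mul_le_mul_of_nonneg_left hI3 (by positivity)
      _ = (K₂ * W₃) * A * ‖b‖ * ‖c‖ := by ring
      _ ≤ P * A * ‖b‖ * ‖c‖ := by gcongr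
  · -- Hessian decay
    obtain ⟨hint, hle⟩ := hR2 x hx
    rw [show (3 : ℝ) - 11 / 4 - 11 / 4 = -(5 / 2 : ℝ) by norm_num] at hle
    have hpt : ∀ᵐ y ∂(volume : Measure (EuclideanSpace ℝ (Fin 3))),
        ‖fderiv ℝ (fun z => fderiv ℝ (newtonFar 1 2) z b) (x - y) c • w y‖ ≤
          K₂ * A * ‖b‖ * ‖c‖ * a ^ (-(1 / 4 : ℝ)) *
            (‖x - y‖ ^ (-(11 / 4 : ℝ)) * ‖y‖ ^ (-(11 / 4 : ℝ))) := by
      filter_upwards [ae_ne_point 0, ae_ne_point x] with y hy0 hyx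
      have hxy : x - y ≠ 0 := sub_ne_zero.2 (Ne.symm hyx)
      have hk : ((1 + ‖x - y‖) ^ 3)⁻¹ ≤ ‖x - y‖ ^ (-(11 / 4 : ℝ)) :=
        inv_one_add_norm_pow_le_rpow (by norm_num) (by norm_num) hxy
      calc ‖fderiv ℝ (fun z => fderiv ℝ (newtonFar 1 2) z b) (x - y) c • w y‖
          ≤ K₂ * A * ‖b‖ * ‖c‖ * (((1 + ‖x - y‖) ^ 3)⁻¹ * ((‖y‖ + a) ^ 3)⁻¹) := hg2 y
        _ ≤ K₂ * A * ‖b‖ * ‖c‖ *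
              (‖x - y‖ ^ (-(11 / 4 : ℝ)) * (a ^ (-(1 / 4 : ℝ)) * ‖y‖ ^ (-(11 / 4 : ℝ)))) :=
            mul_le_mul_of_nonneg_left (mul_le_mul hk (hρ y hy0) (by positivity) (by positivity))
              (by positivity)
        _ = K₂ * A * ‖b‖ * ‖c‖ * a ^ (-(1 / 4 : ℝ)) *
              (‖x - y‖ ^ (-(11 / 4 : ℝ)) * ‖y‖ ^ (-(11 / 4 : ℝ))) := by ring
    calc ∫ y, ‖fderiv ℝ (fun z => fderiv ℝ (newtonFar 1 2) z b) (x - y) c • w y‖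
        ≤ ∫ y, K₂ * A * ‖b‖ * ‖c‖ * a ^ (-(1 / 4 : ℝ)) *
            (‖x - y‖ ^ (-(11 / 4 : ℝ)) * ‖y‖ ^ (-(11 / 4 : ℝ))) :=
          integral_mono_of_nonneg (Eventually.of_forall fun y => norm_nonneg _) (hint.const_mul _) hpt
      _ ≤ K₂ * A * ‖b‖ * ‖c‖ * a ^ (-(1 / 4 : ℝ)) * (R₂ * ‖x‖ ^ (-(5 / 2 : ℝ))) := by
          rw [integral_const_mul]; exact mul_le_mul_of_nonneg_left hle (by positivity)
      _ = (K₂ * a ^ (-(1 / 4 : ℝ)) * R₂) * A * ‖b‖ * ‖c‖ * ‖x‖ ^ (-(5 / 2 : ℝ)) := by ring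
      _ ≤ P * A * ‖b‖ * ‖c‖ * ‖x‖ ^ (-(5 / 2 : ℝ)) := by gcongr

/-! ## The near integrals -/

/-- **Near integrals of an apex-type density.** For `Γ₀ = newtonNear 1 2` (supported in
`‖z‖ ≤ 2`), `a > 0`, `m ∈ ℕ` and `0 ≤ s ≤ m` there is `P ≥ 0` with, for every `A ≥ 0` and every
`G : ℝ³ → ℝ³` with `‖G(y)‖ ≤ A/(‖y‖+a)^m`: `∫ ‖Γ₀(z) G(x-z)‖ dz ≤ P A`, and `≤ P A ‖x‖^{-s}` for
`x ≠ 0` (for `‖x‖ ≥ 4` the density is evaluated at `‖x - z‖ ≥ ‖x‖/2`). [folklore] -/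
theorem exists_near_integrals_le {a : ℝ} (ha : 0 < a) (m : ℕ) {s : ℝ} (hs0 : 0 ≤ s) (hs : s ≤ m) :
    ∃ P : ℝ, 0 ≤ P ∧ ∀ (A : ℝ), 0 ≤ A →
      ∀ G : (EuclideanSpace ℝ (Fin 3)) → (EuclideanSpace ℝ (Fin 3)),
        (∀ y, ‖G y‖ ≤ A * ((‖y‖ + a) ^ m)⁻¹) →
        ∀ x : EuclideanSpace ℝ (Fin 3),
          (∫ z, ‖newtonNear 1 2 z • G (x - z)‖ ≤ P * A) ∧
          (x ≠ 0 → ∫ z, ‖newtonNear 1 2 z • G (x - z)‖ ≤ P * A * ‖x‖ ^ (-s)) := by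
  have hΓi : Integrable (fun z => ‖newtonNear (1 : ℝ) 2 z‖) volume :=
    (integrable_newtonNear zero_le_one one_lt_two).norm
  set L : ℝ := ∫ z, ‖newtonNear (1 : ℝ) 2 z‖ with hL
  have hL0 : 0 ≤ L := integral_nonneg fun z => norm_nonneg _
  refine ⟨L * ((a ^ m)⁻¹ * (4 : ℝ) ^ s + 2 ^ m), by positivity, fun A hA G hG x => ?_⟩
  -- the global bound
  have hglob : ∫ z, ‖newtonNear 1 2 z • G (x - z)‖ ≤ L * (a ^ m)⁻¹ * A := by
    have hpt : ∀ z, ‖newtonNear 1 2 z • G (x - z)‖ ≤ A * (a ^ m)⁻¹ * ‖newtonNear (1 : ℝ) 2 z‖ := by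
      intro z
      rw [norm_smul]
      have h1 : ‖G (x - z)‖ ≤ A * (a ^ m)⁻¹ :=
        (hG _).trans (mul_le_mul_of_nonneg_left (inv_anti₀ (by positivity)
          (pow_le_pow_left₀ ha.le (le_add_of_nonneg_left (norm_nonneg _)) m)) hA)
      calc ‖newtonNear 1 2 z‖ * ‖G (x - z)‖ ≤ ‖newtonNear 1 2 z‖ * (A * (a ^ m)⁻¹) :=
            mul_le_mul_of_nonneg_left h1 (norm_nonneg _)
        _ = A * (a ^ m)⁻¹ * ‖newtonNear (1 : ℝ) 2 z‖ := by ring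
    calc ∫ z, ‖newtonNear 1 2 z • G (x - z)‖ ≤ ∫ z, A * (a ^ m)⁻¹ * ‖newtonNear (1 : ℝ) 2 z‖ :=
          integral_mono_of_nonneg (Eventually.of_forall fun z => norm_nonneg _) (hΓi.const_mul _)
            (Eventually.of_forall hpt)
      _ = L * (a ^ m)⁻¹ * A := by rw [integral_const_mul]; ring
  refine ⟨hglob.trans ?_, fun hx => ?_⟩
  · have h4 : (1 : ℝ) ≤ (4 : ℝ) ^ s := Real.one_le_rpow (by norm_num) hs0
    have : L * (a ^ m)⁻¹ ≤ L * ((a ^ m)⁻¹ * (4 : ℝ) ^ s + 2 ^ m) := by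
      apply mul_le_mul_of_nonneg_left _ hL0
      nlinarith [inv_nonneg.2 (pow_nonneg ha.le m), pow_nonneg (zero_le_two (α := ℝ)) m]
    nlinarith
  have hx0 : 0 < ‖x‖ := norm_pos_iff.2 hx
  by_cases h4x : ‖x‖ < 4
  · -- small `x`: the global bound and `1 ≤ (4/‖x‖)^s`
    have h1 : (1 : ℝ) ≤ (4 : ℝ) ^ s * ‖x‖ ^ (-s) := by
      rw [Real.rpow_neg hx0.le, ← div_eq_mul_inv, ← Real.div_rpow (by norm_num) hx0.le]
      exact Real.one_le_rpow (by rw [le_div_iff₀ hx0]; linarith) hs0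
    calc ∫ z, ‖newtonNear 1 2 z • G (x - z)‖ ≤ L * (a ^ m)⁻¹ * A := hglob
      _ ≤ L * (a ^ m)⁻¹ * A * ((4 : ℝ) ^ s * ‖x‖ ^ (-s)) :=
          le_mul_of_one_le_right (by positivity) h1
      _ ≤ L * ((a ^ m)⁻¹ * (4 : ℝ) ^ s + 2 ^ m) * A * ‖x‖ ^ (-s) := by
          have : (0 : ℝ) ≤ L * 2 ^ m * A * ‖x‖ ^ (-s) := by positivity
          nlinarith
  · -- large `x`: the density is evaluated far from the origin
    rw [not_lt] at h4x
    have hpt : ∀ z, ‖newtonNear 1 2 z • G (x - z)‖ ≤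
        A * 2 ^ m * (‖x‖ ^ m)⁻¹ * ‖newtonNear (1 : ℝ) 2 z‖ := by
      intro z
      by_cases hz : 2 < ‖z‖
      · rw [newtonNear_eq_zero zero_le_one one_lt_two hz.le, zero_smul, norm_zero, norm_zero,
          mul_zero]
      · rw [not_lt] at hz
        have hxz : ‖x‖ / 2 ≤ ‖x - z‖ := by linarith [norm_sub_norm_le x z]
        have h1 : ‖G (x - z)‖ ≤ A * (2 ^ m * (‖x‖ ^ m)⁻¹) := by
          refine (hG _).trans (mul_le_mul_of_nonneg_left ?_ hA)
          rw [← inv_pow, ← inv_pow, ← mul_pow]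
          refine pow_le_pow_left₀ (by positivity) ?_ m
          rw [← div_eq_mul_inv, le_div_iff₀ hx0, inv_mul_le_iff₀ (by positivity)]
          linarith [norm_nonneg (x - z)]
        rw [norm_smul]
        calc ‖newtonNear 1 2 z‖ * ‖G (x - z)‖ ≤ ‖newtonNear 1 2 z‖ * (A * (2 ^ m * (‖x‖ ^ m)⁻¹)) :=
              mul_le_mul_of_nonneg_left h1 (norm_nonneg _)
          _ = A * 2 ^ m * (‖x‖ ^ m)⁻¹ * ‖newtonNear (1 : ℝ) 2 z‖ := by ring
    have hms : (‖x‖ ^ m)⁻¹ ≤ ‖x‖ ^ (-s) := by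
      rw [← Real.rpow_natCast, ← Real.rpow_neg hx0.le]
      exact Real.rpow_le_rpow_of_exponent_le (by linarith) (by linarith)
    calc ∫ z, ‖newtonNear 1 2 z • G (x - z)‖
        ≤ ∫ z, A * 2 ^ m * (‖x‖ ^ m)⁻¹ * ‖newtonNear (1 : ℝ) 2 z‖ :=
          integral_mono_of_nonneg (Eventually.of_forall fun z => norm_nonneg _) (hΓi.const_mul _)
            (Eventually.of_forall hpt)
      _ = L * 2 ^ m * A * (‖x‖ ^ m)⁻¹ := by rw [integral_const_mul]; ring
      _ ≤ L * 2 ^ m * A * ‖x‖ ^ (-s) := mul_le_mul_of_nonneg_left hms (by positivity)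
      _ ≤ L * ((a ^ m)⁻¹ * (4 : ℝ) ^ s + 2 ^ m) * A * ‖x‖ ^ (-s) := by
          have : (0 : ℝ) ≤ L * ((a ^ m)⁻¹ * (4 : ℝ) ^ s) * A * ‖x‖ ^ (-s) := by positivity
          nlinarith

/-! ## Registered sub-goal (helper stub of `stub_coulombEnergyPackage`) -/

/-- **Registered helper stub `stub_newtonPotentialDecay`** (crux stmt-NavierStokesRegularity-11717,
line `finite-energy-log-convexity`, helper of S4-E): the `‖x‖^{-3/4}` decay of the Newtonian
potential of an apex density, as registered. [folklore] -/
theorem stub_newtonPotentialDecay :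
    ∃ K : ℝ, 0 ≤ K ∧ ∀ (a A : ℝ), 0 < a → 0 ≤ A →
      ∀ w : EuclideanSpace ℝ (Fin 3) → EuclideanSpace ℝ (Fin 3),
        (∀ y, ‖w y‖ ≤ A * ((‖y‖ + a) ^ 3)⁻¹) →
        ∀ x : EuclideanSpace ℝ (Fin 3), x ≠ 0 →
          ∫ y, ‖newtonKernel (x - y) • w y‖ ≤ K * A * a ^ (-(1 / 4 : ℝ)) * ‖x‖ ^ (-(3 / 4 : ℝ)) :=
  exists_integral_norm_newtonKernel_smul_le

end Summit.NavierStokesRegularity.NavierStokesRegularity.Theorems.RellichScarScarRigidity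

end
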